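import Mathlib
import Summits.Ventures.PercRepro2.Defs
import Summits.Ventures.PercRepro2.Independence
import Summits.Ventures.PercRepro2.Harris
import Summits.Ventures.PercRepro2.Graph
import Summits.Ventures.PercRepro2.Events
import Summits.Ventures.PercRepro2.BasePendant
import Summits.Ventures.PercRepro2.BHKEvents
import Summits.Ventures.PercRepro2.ZCPendantFirstOrder

/-!
# Row 2′ZC at a pendant root: the second-order coefficient is nonnegative, and the row reduces
to the leaf edge pinned open
(blind cell PercRepro2, mine-a g30; MINE-A.md §84)

Let the root `a₁` be a LEAF with only edge `f = {a₁, x}` of weight `t`.  By `zc_pendant_expansion`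
the (ZC) expression is `Z = t·C₁ + t²·C₂ + t³·C₃`; in the Bernstein basis of degree three,

  `Z = t · ( C₁·(1 − t)² + c₂·t(1 − t) + Z(P₁)·t² )`,   `c₂ := C₂ + 2·C₁`,   `Z(P₁) = C₁ + C₂ + C₃`,

where `P₁` is the law with `f` pinned open.  `C₁ ≥ 0` is a Harris covariance
(`first_order_coeff_nonneg`).  This file proves the SECOND-ORDER coefficient nonnegative:

  `c₂ = (P₁(e Lᶜ) + P₁(eᶜLᶜγᶜ)) · Cov₁(U ∩ e, γ) + P₁(γ) · Cov₁(U ∩ e, L ∪ γ)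
        + P₁(eᶜ) · Cov₁(U, γ) + [ P₁(U eᶜ) P₁(eᶜLᶜγ) − P₁(U eᶜ γ) P₁(eᶜ) ]`
  (`second_order_coeff_eq`),

three Harris covariances of increasing events and one van den Berg–Häggström–Kahn cross-cluster
slack (`bhk_cross_cluster`, Thm 1.4 of BHK06: given `a₁ ↮ a₃`, the up-set event of `C(a₁)` and
`{o ∈ C(a₃)}` are negatively correlated).  The certificate was found by an exact LP over the
Harris/BHK dictionary (mine-a g30, codes/c2cert.py) and is a polynomial identity modulo the
partition `P₁(eL) + P₁(eLᶜ) + P₁(eᶜL) + P₁(eᶜLᶜγᶜ) + P₁(eᶜLᶜγ) = 1`.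

Consequence (`zc_pendant_of_pinned_open`): **(ZC) at a pendant root follows from (ZC) with the leaf
edge pinned open**, i.e. from the row on the smaller graph `G − a₁` with root `x`: for every
`t ∈ [0, 1]`, `Z(p) ≥ t³ · Z(P₁)`.
-/

namespace Summit.Ventures.PercRepro2

namespace ZCPendant

section Algebra

variable {R : Type*} [CommRing R]

/-- The algebraic heart of the second-order coefficient: modulo `g + X + Y + D + B = 1`, the
Bernstein coefficient `C₂ + 2·C₁` (written in the variables `a = P₁(U e L)`, `c = P₁(U e Lᶜ)`,
`w = P₁(U eᶜ)`, `e₁ = P₁(U eᶜ γ)`, `g = P₁(eL)`, `X = P₁(eLᶜ)`, `Y = P₁(eᶜL)`, `D = P₁(eᶜLᶜγᶜ)`,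
`B = P₁(eᶜLᶜγ)`) is the certificate combination. -/
lemma second_order_identity (a c w e₁ g X Y D B : R) (hσ : g + X + Y + D + B = 1) :
    (D - (1 - (g + B))) * a - (1 - (g + B)) * ((a + c + w) * g) - (B - (g + B)) * c +
          (g + B) * ((a + c + w) * X) +
        2 * ((1 - (g + B)) * a - (g + B) * c) =
      (X + D) * (a - (g + B) * (a + c)) + (g + B) * (a - (a + c) * (g + Y + B)) +
        (Y + D + B) * (a + e₁ - (a + c + w) * (g + B)) + (w * B - e₁ * (Y + D + B)) := by
  linear_combination (w * B + w * g + 2 * c * B + 2 * c * g - a + 2 * a * B + 2 * a * g) * hσ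

/-- The Bernstein form of a cubic without constant term. -/
lemma cubic_bernstein (t C₁ C₂ C₃ : R) :
    t * C₁ + t ^ 2 * C₂ + t ^ 3 * C₃ =
      t * (C₁ * (1 - t) ^ 2 + (C₂ + 2 * C₁) * (t * (1 - t)) + (C₁ + C₂ + C₃) * t ^ 2) := by
  ring

end Algebra

section Sets

variable {V : Type*} {E : Type*} (ends : E → Sym2 V) (a₁ a₃ o : V)

/-- `{a₁ ↮ a₃} ∩ {a₃ ↔ o} = {a₁ ↮ a₃} ∩ {a₁ ↮ o} ∩ {a₃ ↔ o}`. -/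
lemma compl_inter_connEvent_eq :
    (connEvent ends a₁ a₃)ᶜ ∩ connEvent ends a₃ o =
      (connEvent ends a₁ a₃)ᶜ ∩ (connEvent ends a₁ o)ᶜ ∩ connEvent ends a₃ o := by
  ext ω
  simp only [Set.mem_inter_iff, Set.mem_compl_iff, mem_connEvent]
  constructor
  · rintro ⟨h1, h3⟩
    exact ⟨⟨h1, fun h2 => h1 (conn_trans h2 (conn_symm h3))⟩, h3⟩
  · rintro ⟨⟨h1, _⟩, h3⟩
    exact ⟨h1, h3⟩

/-- `{a₁ ↔ o} ∩ {a₃ ↔ o} = {a₁ ↔ a₃} ∩ {a₁ ↔ o}`. -/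
lemma connEvent_o_inter_eq :
    connEvent ends a₁ o ∩ connEvent ends a₃ o = connEvent ends a₁ a₃ ∩ connEvent ends a₁ o := by
  ext ω
  simp only [Set.mem_inter_iff, mem_connEvent]
  constructor
  · rintro ⟨h2, h3⟩
    exact ⟨conn_trans h2 (conn_symm h3), h2⟩
  · rintro ⟨h1, h2⟩
    exact ⟨h2, conn_trans (conn_symm h1) h2⟩

/-- `{a₁ ↔ a₃} ∩ ({a₁ ↔ o} ∪ {a₃ ↔ o}) = {a₁ ↔ a₃} ∩ {a₁ ↔ o}`. -/
lemma connEvent_inter_union_eq :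
    connEvent ends a₁ a₃ ∩ (connEvent ends a₁ o ∪ connEvent ends a₃ o) =
      connEvent ends a₁ a₃ ∩ connEvent ends a₁ o := by
  ext ω
  simp only [Set.mem_inter_iff, Set.mem_union, mem_connEvent]
  constructor
  · rintro ⟨h1, h2 | h3⟩
    · exact ⟨h1, h2⟩
    · exact ⟨h1, conn_trans h1 h3⟩
  · rintro ⟨h1, h2⟩
    exact ⟨h1, Or.inl h2⟩

/-- `{C(a₃) ∈ {W | o ∈ W}} = {a₃ ↔ o}`. -/
lemma clusterInEvent_mem_o_eq :
    clusterInEvent ends a₃ {W : Set V | o ∈ W} = connEvent ends a₃ o := by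
  ext ω
  simp only [mem_clusterInEvent, Set.mem_setOf_eq, mem_cluster, mem_connEvent]

/-- `{W | o ∈ W}` is an up-set of vertex sets. -/
lemma isUpperSet_mem_o : IsUpperSet {W : Set V | o ∈ W} :=
  fun _ _ h hW => h hW

end Sets

section SecondOrder

variable {V : Type*} {E : Type*} [Fintype E] [DecidableEq E] [Fintype V] [DecidableEq V]
  {R : Type*} [Field R] [LinearOrder R] [IsStrictOrderedRing R]
  {ends : E → Sym2 V} {a₁ x : V} {f : E}

omit [Fintype V] [DecidableEq V] in
/-- **The second-order Bernstein coefficient `C₂ + 2·C₁` of the pendant expansion is a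
certificate combination**: three Harris covariances and one BHK cross-cluster slack, with
nonnegative probability multipliers. -/
theorem second_order_coeff_eq (hf : ends f = s(a₁, x)) (hleaf : ∀ e, a₁ ∈ ends e → e = f)
    (hx : a₁ ≠ x) (p : E → R) (𝓔 : Set (Set V)) {a₃ o : V} (h3 : a₃ ≠ a₁) (ho : o ≠ a₁) :
    let e := connEvent ends a₁ a₃
    let L := connEvent ends a₁ o
    let γ := connEvent ends a₃ o
    let U := clusterInEvent ends a₁ 𝓔
    let P₁ := Function.update p f (1 : R)
    let P₀ := Function.update p f (0 : R)
    let D₁ := prob P₁ (eᶜ ∩ Lᶜ ∩ γᶜ)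
    let B₁ := prob P₁ (eᶜ ∩ Lᶜ ∩ γ)
    let D₀ := prob P₀ γᶜ
    let B₀ := prob P₀ γ
    let C₁ := D₀ * prob P₁ (U ∩ (e ∩ L)) - B₀ * prob P₁ (U ∩ (e ∩ Lᶜ))
    let C₂ := (D₁ - D₀) * prob P₁ (U ∩ (e ∩ L)) - D₀ * (prob P₁ U * prob P₁ (e ∩ L)) -
      (B₁ - B₀) * prob P₁ (U ∩ (e ∩ Lᶜ)) + B₀ * (prob P₁ U * prob P₁ (e ∩ Lᶜ))
    C₂ + 2 * C₁ =
      (prob P₁ (e ∩ Lᶜ) + D₁) * (prob P₁ (U ∩ e ∩ γ) - prob P₁ γ * prob P₁ (U ∩ e)) +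
        prob P₁ γ * (prob P₁ (U ∩ (e ∩ L)) - prob P₁ (U ∩ e) * prob P₁ (L ∪ γ)) +
        prob P₁ eᶜ * (prob P₁ (U ∩ γ) - prob P₁ U * prob P₁ γ) +
        (prob P₁ (U ∩ eᶜ) * B₁ - prob P₁ (U ∩ eᶜ ∩ γ) * prob P₁ eᶜ) := by
  intro e L γ U P₁ P₀ D₁ B₁ D₀ B₀ C₁ C₂
  -- the pinned-closed constants are `P₁(γ)`, `P₁(γᶜ)`
  have hγ0 : prob P₀ γ = prob P₁ γ := by
    rw [prob_update_zero_connEvent hf hleaf hx p h3 ho, prob_update_one_connEvent hf hleaf hx p h3 ho]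
  have hγ : B₀ = prob P₁ γ := hγ0
  have hγc : D₀ = 1 - prob P₁ γ := by
    show prob P₀ γᶜ = 1 - prob P₁ γ
    rw [prob_compl, hγ0]
  -- set identities
  have s1 : γ ∩ e = e ∩ L := by
    rw [Set.inter_comm, connEvent_inter_eq_inter_connEvent]
  have s2 : γ ∩ eᶜ = eᶜ ∩ Lᶜ ∩ γ := by
    rw [Set.inter_comm, compl_inter_connEvent_eq]
  have s3 : L ∩ γ = e ∩ L := connEvent_o_inter_eq ends a₁ a₃ o
  have s4 : L ∩ e = e ∩ L := Set.inter_comm _ _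
  have s5 : U ∩ e ∩ γ = U ∩ (e ∩ L) := by
    rw [Set.inter_assoc, connEvent_inter_eq_inter_connEvent]
  have s6 : U ∩ γ ∩ e = U ∩ (e ∩ L) := by
    rw [Set.inter_assoc, s1]
  have s7 : U ∩ γ ∩ eᶜ = U ∩ eᶜ ∩ γ := by
    rw [Set.inter_assoc, Set.inter_assoc, Set.inter_comm γ]
  -- probability relations under `P₁`
  have hq : prob P₁ γ = prob P₁ (e ∩ L) + B₁ := by
    have := prob_inter_add_prob_inter_compl P₁ γ e
    rw [s1, s2] at this
    linear_combination -this
  have he : prob P₁ e = prob P₁ (e ∩ L) + prob P₁ (e ∩ Lᶜ) :=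
    (prob_inter_add_prob_inter_compl P₁ e L).symm
  have hec : prob P₁ eᶜ = prob P₁ (eᶜ ∩ L) + prob P₁ (eᶜ ∩ Lᶜ) :=
    (prob_inter_add_prob_inter_compl P₁ eᶜ L).symm
  have hecLc : prob P₁ (eᶜ ∩ Lᶜ) = B₁ + D₁ :=
    (prob_inter_add_prob_inter_compl P₁ (eᶜ ∩ Lᶜ) γ).symm
  have hcompl : prob P₁ eᶜ = 1 - prob P₁ e := prob_compl P₁ e
  have hL : prob P₁ L = prob P₁ (e ∩ L) + prob P₁ (eᶜ ∩ L) := by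
    have := prob_inter_add_prob_inter_compl P₁ L e
    rw [s4, Set.inter_comm L eᶜ] at this
    exact this.symm
  have hLuγ : prob P₁ (L ∪ γ) = prob P₁ (e ∩ L) + prob P₁ (eᶜ ∩ L) + B₁ := by
    have := prob_union_add_prob_inter P₁ L γ
    rw [s3] at this
    linear_combination this + hL + hq
  have hU : prob P₁ U = prob P₁ (U ∩ e) + prob P₁ (U ∩ eᶜ) :=
    (prob_inter_add_prob_inter_compl P₁ U e).symm
  have hUe : prob P₁ (U ∩ e) = prob P₁ (U ∩ (e ∩ L)) + prob P₁ (U ∩ (e ∩ Lᶜ)) := by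
    have := prob_inter_add_prob_inter_compl P₁ (U ∩ e) L
    rw [Set.inter_assoc, Set.inter_assoc] at this
    exact this.symm
  have hUγ : prob P₁ (U ∩ γ) = prob P₁ (U ∩ (e ∩ L)) + prob P₁ (U ∩ eᶜ ∩ γ) := by
    have := prob_inter_add_prob_inter_compl P₁ (U ∩ γ) e
    rw [s6, s7] at this
    exact this.symm
  have hUeγ : prob P₁ (U ∩ e ∩ γ) = prob P₁ (U ∩ (e ∩ L)) := by rw [s5]
  -- the partition of unity
  have hσ : prob P₁ (e ∩ L) + prob P₁ (e ∩ Lᶜ) + prob P₁ (eᶜ ∩ L) + D₁ + B₁ = 1 := by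
    linear_combination -he - hec - hecLc + hcompl
  have hPec : prob P₁ eᶜ = prob P₁ (eᶜ ∩ L) + D₁ + B₁ := by
    linear_combination hec + hecLc
  -- assemble
  have key := second_order_identity (R := R) (prob P₁ (U ∩ (e ∩ L))) (prob P₁ (U ∩ (e ∩ Lᶜ)))
    (prob P₁ (U ∩ eᶜ)) (prob P₁ (U ∩ eᶜ ∩ γ)) (prob P₁ (e ∩ L)) (prob P₁ (e ∩ Lᶜ))
    (prob P₁ (eᶜ ∩ L)) D₁ B₁ hσ
  show C₂ + 2 * C₁ = _
  simp only [C₂, C₁]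
  rw [hγ, hγc, hq, hU, hUe, hUγ, hUeγ, hLuγ, hPec]
  linear_combination key

/-- **The second-order pendant coefficient of (ZC) is nonnegative**: each of the four terms of
`second_order_coeff_eq` is a product of probabilities with a Harris covariance, or the BHK
cross-cluster slack. -/
theorem second_order_coeff_nonneg (hf : ends f = s(a₁, x)) (hleaf : ∀ e, a₁ ∈ ends e → e = f)
    (hx : a₁ ≠ x) (p : E → R) (hp : IsProbVec p) {𝓔 : Set (Set V)} (h𝓔 : IsUpperSet 𝓔)
    {a₃ o : V} (h3 : a₃ ≠ a₁) (ho : o ≠ a₁) :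
    let e := connEvent ends a₁ a₃
    let L := connEvent ends a₁ o
    let γ := connEvent ends a₃ o
    let U := clusterInEvent ends a₁ 𝓔
    let P₁ := Function.update p f (1 : R)
    let P₀ := Function.update p f (0 : R)
    let D₁ := prob P₁ (eᶜ ∩ Lᶜ ∩ γᶜ)
    let B₁ := prob P₁ (eᶜ ∩ Lᶜ ∩ γ)
    let D₀ := prob P₀ γᶜ
    let B₀ := prob P₀ γ
    let C₁ := D₀ * prob P₁ (U ∩ (e ∩ L)) - B₀ * prob P₁ (U ∩ (e ∩ Lᶜ))
    let C₂ := (D₁ - D₀) * prob P₁ (U ∩ (e ∩ L)) - D₀ * (prob P₁ U * prob P₁ (e ∩ L)) -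
      (B₁ - B₀) * prob P₁ (U ∩ (e ∩ Lᶜ)) + B₀ * (prob P₁ U * prob P₁ (e ∩ Lᶜ))
    0 ≤ C₂ + 2 * C₁ := by
  intro e L γ U P₁ P₀ D₁ B₁ D₀ B₀ C₁ C₂
  have hP₁ : IsProbVec P₁ := hp.update f zero_le_one le_rfl
  have hU : IsUpperSet U := isUpperSet_clusterInEvent ends a₁ h𝓔
  have hUe : IsUpperSet (U ∩ e) := hU.inter (isUpperSet_connEvent ends a₁ a₃)
  have hγ : IsUpperSet γ := isUpperSet_connEvent ends a₃ o
  have hLγ : IsUpperSet (L ∪ γ) := (isUpperSet_connEvent ends a₁ o).union hγ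
  -- term 1: Harris for `U ∩ e` and `γ`
  have t1 : 0 ≤ prob P₁ (U ∩ e ∩ γ) - prob P₁ γ * prob P₁ (U ∩ e) :=
    first_order_coeff_nonneg (ends := ends) (a₁ := a₁) (f := f) p hp h𝓔 a₃ o
  -- term 2: Harris for `U ∩ e` and `L ∪ γ`
  have t2 : 0 ≤ prob P₁ (U ∩ (e ∩ L)) - prob P₁ (U ∩ e) * prob P₁ (L ∪ γ) := by
    have := prob_mul_prob_le_prob_inter hP₁ hUe hLγ
    rw [Set.inter_assoc, connEvent_inter_union_eq] at this
    linarith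
  -- term 3: Harris for `U` and `γ`
  have t3 : 0 ≤ prob P₁ (U ∩ γ) - prob P₁ U * prob P₁ γ := by
    have := prob_mul_prob_le_prob_inter hP₁ hU hγ
    linarith
  -- term 4: BHK cross-cluster (given `a₁ ↮ a₃`, `C(a₁) ∈ 𝓔` and `o ∈ C(a₃)` anti-correlated)
  have t4 : 0 ≤ prob P₁ (U ∩ eᶜ) * B₁ - prob P₁ (U ∩ eᶜ ∩ γ) * prob P₁ eᶜ := by
    have := bhk_cross_cluster P₁ hP₁ ends a₁ a₃ h𝓔 (isUpperSet_mem_o (V := V) o)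
    rw [clusterInEvent_mem_o_eq] at this
    have s2 : γ ∩ eᶜ = eᶜ ∩ Lᶜ ∩ γ := by
      rw [Set.inter_comm, compl_inter_connEvent_eq]
    have s7 : U ∩ γ ∩ eᶜ = U ∩ eᶜ ∩ γ := by
      rw [Set.inter_assoc, Set.inter_assoc, Set.inter_comm γ]
    rw [s2, s7] at this
    linarith
  have hD₁ : 0 ≤ D₁ := prob_nonneg hP₁ _
  have hX : 0 ≤ prob P₁ (e ∩ Lᶜ) := prob_nonneg hP₁ _
  have hqn : 0 ≤ prob P₁ γ := prob_nonneg hP₁ _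
  have hecn : 0 ≤ prob P₁ eᶜ := prob_nonneg hP₁ _
  rw [second_order_coeff_eq hf hleaf hx p 𝓔 h3 ho]
  have m1 := mul_nonneg (add_nonneg hX hD₁) t1
  have m2 := mul_nonneg hqn t2
  have m3 := mul_nonneg hecn t3
  linarith

end SecondOrder

section Reduction

variable {V : Type*} {E : Type*} [Fintype E] [DecidableEq E] [Fintype V] [DecidableEq V]
  {R : Type*} [Field R] [LinearOrder R] [IsStrictOrderedRing R]
  {ends : E → Sym2 V} {a₁ x : V} {f : E}

/-- **(ZC) at a pendant root follows from (ZC) with the leaf edge pinned open.**  For the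
leaf root `a₁` (only edge `f = {a₁, x}`, weight `t = p f`), every cluster up-set `𝓔` with
`{a₁} ∉ 𝓔` and marks `a₃, o ≠ a₁`:
`Z(p) ≥ t³ · Z(update p f 1)`; in particular `0 ≤ Z(update p f 1)` implies `0 ≤ Z(p)`.
Proof: `Z(p) = t·(C₁(1−t)² + (C₂+2C₁)·t(1−t) + Z(P₁)·t²)` with `C₁ ≥ 0` (Harris) and
`C₂ + 2C₁ ≥ 0` (`second_order_coeff_nonneg`). -/
theorem zc_pendant_ge_cube_mul (hf : ends f = s(a₁, x)) (hleaf : ∀ e, a₁ ∈ ends e → e = f)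
    (hx : a₁ ≠ x) (p : E → R) (hp : IsProbVec p) {𝓔 : Set (Set V)} (h𝓔 : IsUpperSet 𝓔)
    (hE1 : ({a₁} : Set V) ∉ 𝓔) {a₃ o : V} (h3 : a₃ ≠ a₁) (ho : o ≠ a₁) :
    let e := connEvent ends a₁ a₃
    let L := connEvent ends a₁ o
    let γ := connEvent ends a₃ o
    let U := clusterInEvent ends a₁ 𝓔
    let P₁ := Function.update p f (1 : R)
    (p f) ^ 3 *
        (prob P₁ (eᶜ ∩ Lᶜ ∩ γᶜ) * (prob P₁ (U ∩ (e ∩ L)) - prob P₁ U * prob P₁ (e ∩ L)) -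
          prob P₁ (eᶜ ∩ Lᶜ ∩ γ) * (prob P₁ (U ∩ (e ∩ Lᶜ)) - prob P₁ U * prob P₁ (e ∩ Lᶜ))) ≤
      prob p (eᶜ ∩ Lᶜ ∩ γᶜ) * (prob p (U ∩ (e ∩ L)) - prob p U * prob p (e ∩ L)) -
        prob p (eᶜ ∩ Lᶜ ∩ γ) * (prob p (U ∩ (e ∩ Lᶜ)) - prob p U * prob p (e ∩ Lᶜ)) := by
  simp only
  have hexp := zc_pendant_expansion hf hleaf hx p hE1 h3 ho
  have hexp1 := zc_pendant_expansion hf hleaf hx (Function.update p f 1) hE1 h3 ho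
  simp only [Function.update_idem, Function.update_self, one_pow, one_mul] at hexp1
  simp only at hexp
  have hc1 := first_order_coeff_nonneg (ends := ends) (a₁ := a₁) (f := f) p hp h𝓔 a₃ o
  have hc1' := first_order_coeff_eq_cov hf hleaf hx p 𝓔 h3 ho
  simp only at hc1 hc1'
  have hc2 := second_order_coeff_nonneg hf hleaf hx p hp h𝓔 h3 ho
  simp only at hc2
  have ht0 : 0 ≤ p f := hp.nonneg f
  have ht1 : p f ≤ 1 := hp.le_one f
  rw [hexp, cubic_bernstein, hexp1]
  rw [← hc1'] at hc1
  have h1t : 0 ≤ 1 - p f := by linarith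
  have hsq : 0 ≤ (1 - p f) ^ 2 := sq_nonneg _
  have htt : 0 ≤ p f * (1 - p f) := mul_nonneg ht0 h1t
  have hA := mul_nonneg hc1 hsq
  have hB := mul_nonneg hc2 htt
  nlinarith [mul_nonneg ht0 (add_nonneg hA hB), pow_nonneg ht0 2, pow_nonneg ht0 3]

/-- **Pendant reduction of row 2′ZC**: if (ZC) holds with the leaf edge pinned open, it holds for
every weight of the leaf edge. -/
theorem zc_pendant_of_pinned_open (hf : ends f = s(a₁, x)) (hleaf : ∀ e, a₁ ∈ ends e → e = f)
    (hx : a₁ ≠ x) (p : E → R) (hp : IsProbVec p) {𝓔 : Set (Set V)} (h𝓔 : IsUpperSet 𝓔)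
    (hE1 : ({a₁} : Set V) ∉ 𝓔) {a₃ o : V} (h3 : a₃ ≠ a₁) (ho : o ≠ a₁) :
    let e := connEvent ends a₁ a₃
    let L := connEvent ends a₁ o
    let γ := connEvent ends a₃ o
    let U := clusterInEvent ends a₁ 𝓔
    let P₁ := Function.update p f (1 : R)
    0 ≤ prob P₁ (eᶜ ∩ Lᶜ ∩ γᶜ) * (prob P₁ (U ∩ (e ∩ L)) - prob P₁ U * prob P₁ (e ∩ L)) -
          prob P₁ (eᶜ ∩ Lᶜ ∩ γ) * (prob P₁ (U ∩ (e ∩ Lᶜ)) - prob P₁ U * prob P₁ (e ∩ Lᶜ)) →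
      0 ≤ prob p (eᶜ ∩ Lᶜ ∩ γᶜ) * (prob p (U ∩ (e ∩ L)) - prob p U * prob p (e ∩ L)) -
        prob p (eᶜ ∩ Lᶜ ∩ γ) * (prob p (U ∩ (e ∩ Lᶜ)) - prob p U * prob p (e ∩ Lᶜ)) := by
  simp only
  intro hZ1
  have h := zc_pendant_ge_cube_mul hf hleaf hx p hp h𝓔 hE1 h3 ho
  simp only at h
  have ht0 : 0 ≤ p f := hp.nonneg f
  exact le_trans (mul_nonneg (pow_nonneg ht0 3) hZ1) h

end Reduction

end ZCPendant

end Summit.Ventures.PercRepro2
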